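import Summits.ValiantsHypothesis.ValiantsHypothesis.Theorems.SymPencilPerFourInnerRankRows

/-!
# Route `SymPencil` — inner rank of the `2 | 2` row split of `per_4`, II: the family step
# (`--supports` stmt-ValiantsHypothesis-5674 `SdcSuperquadratic`; toward the cell hypothesis `H88` /
# Task T2 of `Cruxes/SdcSuperquadratic/NEXT-RUNG-25.md`; rung currency only)

Setting and notation as in `SymPencilPerFourInnerRankRows`: a joint `8`-square family
`Σ_r c_r t_r(u, y)² = per (a; b; y₂; y₃)` (`hJ`), `u = (a, b)`, `y = (y₂, y₃)`, `t_r` bilinear.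

* `polar` — polarisation of `hJ` in `y`:
  `2 Σ_r c_r t_r(u, y) t_r(u, y') = per (a; b; y₂; y₃') + per (a; b; y₂'; y₃)`.
* `coeff_ne_zero` — every `c_r ≠ 0`: otherwise the seven remaining forms at `u = (𝟙, 𝟙)` have a
  common zero `w ≠ 0` on the `8`-dimensional `y`-space, which would be a radical vector of the
  non-degenerate pairing `per (𝟙; 𝟙; v; w) = 2((Σv)(Σw) - v·w)`.
* `eq_zero_of_forall_left/right` — no test vector `(v, 0)` / `(0, w)` is killed by all `t_r(u, ·)`.
* **`family_step`** — at `u = (a, β e₂ + γ e₃)` with `a₀ a₁ β γ (a₂ γ + a₃ β) ≠ 0` and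
  `k = β e₂ - γ e₃`: the radical vector `(k, 0)` of the pairing forces a non-zero common zero `w`
  of the eight forms `t_r(u, ·)` (else `y ↦ (t_r(u,y))_r` is bijective and `(k, 0)` itself is
  killed); both halves of `w` are kernel vectors of the corank-one pairing, `w = (α k, α' k)`;
  differentiating `hJ` along `u ↦ u + (0, e₀)` gives `α α' per (a; e₀; k; k) = 0` with
  `per (a; e₀; k; k) = -2 a₁ β γ ≠ 0`; so `α α' = 0`, i.e. `t_r(u, (k, 0)) = 0 ∀ r` or
  `t_r(u, (0, k)) = 0 ∀ r`.
* **`family₂₃`** — one of the two alternatives holds on the WHOLE linear family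
  `{(a, b) : b ∈ span(e₂, e₃)}` (products `t_r(u,(k,0)) · t_{r'}(u,(0,k)) · a₀a₁b₂b₃(a₂b₃+a₃b₂)`
  vanish everywhere and are polynomial along lines:
  `SymPencilPerFourHessianMinors.forall_eq_zero_or_of_mul₃`).

The companion `SymPencilPerFourInnerRankNine` runs `family₂₃` over all column pairs and both row
orders by symmetry and derives the contradiction.  Honest framing: lemmas; `sdc(per_4) ≥ 25`
unchanged; the crux `SdcSuperquadratic` and `VP ≠ VNP` untouched.  No definitions, no named facts.
[folklore]
-/

noncomputable section

-- single-conjunct layout: Sub = Summit, duplicated namespace component intended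
set_option linter.dupNamespace false

namespace Summit.ValiantsHypothesis.ValiantsHypothesis.Theorems.SymPencilPerFourInnerRankFamily

open Matrix Finset Module Polynomial
open Summit.ValiantsHypothesis.ValiantsHypothesis.Theorems.SymPencilPerFourHessianMinors
open Summit.ValiantsHypothesis.ValiantsHypothesis.Theorems.SymPencilPerFourInnerRankRows

variable {K : Type*} [Field K]
/-! ### Consequences of a joint `8`-square family: polarisation, all weights non-zero -/

/-- **Polarisation of the joint identity in `y`.** [folklore] -/
theorem polar (c : Fin 8 → K)
    (t : Fin 8 → (((Fin 4 → K) × (Fin 4 → K)) →ₗ[K] ((Fin 4 → K) × (Fin 4 → K)) →ₗ[K] K))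
    (hJ : ∀ a b y₂ y₃ : Fin 4 → K,
      ∑ r, c r * (t r (a, b) (y₂, y₃)) ^ 2 = (Matrix.of ![a, b, y₂, y₃]).permanent)
    (a b y₂ y₃ y₂' y₃' : Fin 4 → K) :
    2 * ∑ r, c r * t r (a, b) (y₂, y₃) * t r (a, b) (y₂', y₃') =
      (Matrix.of ![a, b, y₂, y₃']).permanent + (Matrix.of ![a, b, y₂', y₃]).permanent := by
  have h1 := hJ a b (y₂ + y₂') (y₃ + y₃')
  have h2 := hJ a b y₂ y₃
  have h3 := hJ a b y₂' y₃'
  have hsplit : ∀ r, t r (a, b) (y₂ + y₂', y₃ + y₃') = t r (a, b) (y₂, y₃) + t r (a, b) (y₂', y₃') :=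
    fun r => by rw [← map_add]; rfl
  simp_rw [hsplit] at h1
  rw [per_add_row₂, per_add_row₃, per_add_row₃] at h1
  have hsq : ∑ r, c r * (t r (a, b) (y₂, y₃) + t r (a, b) (y₂', y₃')) ^ 2 =
      ∑ r, c r * (t r (a, b) (y₂, y₃)) ^ 2 +
        2 * ∑ r, c r * t r (a, b) (y₂, y₃) * t r (a, b) (y₂', y₃') +
        ∑ r, c r * (t r (a, b) (y₂', y₃')) ^ 2 := by
    rw [Finset.mul_sum, ← Finset.sum_add_distrib, ← Finset.sum_add_distrib]
    exact Finset.sum_congr rfl fun r _ => by ring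
  linear_combination h1 - h2 - h3 - hsq

/-- **All weights of a joint `8`-square family are non-zero** (the pairing at `a = b = 𝟙` is
non-degenerate on the `8`-dimensional `y`-space, so it is not a sum of `7` products).
[folklore] -/
theorem coeff_ne_zero [CharZero K] (c : Fin 8 → K)
    (t : Fin 8 → (((Fin 4 → K) × (Fin 4 → K)) →ₗ[K] ((Fin 4 → K) × (Fin 4 → K)) →ₗ[K] K))
    (hJ : ∀ a b y₂ y₃ : Fin 4 → K,
      ∑ r, c r * (t r (a, b) (y₂, y₃)) ^ 2 = (Matrix.of ![a, b, y₂, y₃]).permanent)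
    (r₀ : Fin 8) : c r₀ ≠ 0 := by
  intro hc
  set o : Fin 4 → K := fun _ => 1 with ho
  -- the seven remaining forms at the base point `(𝟙, 𝟙)` have a common zero `w ≠ 0`
  let L : ((Fin 4 → K) × (Fin 4 → K)) →ₗ[K] (Fin 7 → K) :=
    LinearMap.pi fun i => t (r₀.succAbove i) (o, o)
  have hker : LinearMap.ker L ≠ ⊥ :=
    LinearMap.ker_ne_bot_of_finrank_lt (by
      rw [finrank_prod, finrank_fintype_fun_eq_card, finrank_fintype_fun_eq_card,
        Fintype.card_fin, Fintype.card_fin]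
      norm_num)
  obtain ⟨w, hw, hw0⟩ := Submodule.exists_mem_ne_zero_of_ne_bot hker
  have hL : ∀ i, t (r₀.succAbove i) (o, o) w = 0 := fun i => by
    have := congr_fun (LinearMap.mem_ker.1 hw) i
    simpa [L] using this
  have hzero : ∀ r, c r * t r (o, o) (w.1, w.2) = 0 := by
    intro r
    by_cases hr : r = r₀
    · rw [hr, hc, zero_mul]
    · obtain ⟨i, hi⟩ := Fin.exists_succAbove_eq hr
      rw [← hi, Prod.mk.eta, hL i, mul_zero]
  have hpol : ∀ y₂' y₃' : Fin 4 → K,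
      (Matrix.of ![o, o, w.1, y₃']).permanent + (Matrix.of ![o, o, y₂', w.2]).permanent = 0 := by
    intro y₂' y₃'
    rw [← polar c t hJ o o w.1 w.2 y₂' y₃']
    rw [show ∑ r, c r * t r (o, o) (w.1, w.2) * t r (o, o) (y₂', y₃') = 0 from
      Finset.sum_eq_zero fun r _ => by rw [hzero r, zero_mul], mul_zero]
  have hw1 : w.1 = 0 := by
    refine eq_zero_of_per_ones w.1 fun y => ?_
    have := hpol 0 y
    rwa [per_zero_row₂, add_zero] at this
  have hw2 : w.2 = 0 := by
    refine eq_zero_of_per_ones w.2 fun y => ?_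
    have := hpol y 0
    rwa [per_zero_row₃, zero_add, per_swap_row₂₃] at this
  exact hw0 (Prod.ext hw1 hw2)

/-- **No column of the `y₂`-block vanishes identically**: if `t_r(u, (v, 0)) = 0` for all `u, r`
then `v = 0`. [folklore] -/
theorem eq_zero_of_forall_left (c : Fin 8 → K)
    (t : Fin 8 → (((Fin 4 → K) × (Fin 4 → K)) →ₗ[K] ((Fin 4 → K) × (Fin 4 → K)) →ₗ[K] K))
    (hJ : ∀ a b y₂ y₃ : Fin 4 → K,
      ∑ r, c r * (t r (a, b) (y₂, y₃)) ^ 2 = (Matrix.of ![a, b, y₂, y₃]).permanent)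
    [CharZero K] (v : Fin 4 → K) (hv : ∀ (a b : Fin 4 → K) (r : Fin 8), t r (a, b) (v, 0) = 0) :
    v = 0 := by
  set o : Fin 4 → K := fun _ => 1 with ho
  refine eq_zero_of_per_ones v fun y => ?_
  have h := polar c t hJ o o v 0 0 y
  rw [per_zero_row₂, add_zero] at h
  rw [← h]
  rw [show ∑ r, c r * t r (o, o) (v, 0) * t r (o, o) (0, y) = 0 from
    Finset.sum_eq_zero fun r _ => by rw [hv, mul_zero, zero_mul], mul_zero]

/-- **No column of the `y₃`-block vanishes identically**: if `t_r(u, (0, w)) = 0` for all `u, r`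
then `w = 0`. [folklore] -/
theorem eq_zero_of_forall_right (c : Fin 8 → K)
    (t : Fin 8 → (((Fin 4 → K) × (Fin 4 → K)) →ₗ[K] ((Fin 4 → K) × (Fin 4 → K)) →ₗ[K] K))
    (hJ : ∀ a b y₂ y₃ : Fin 4 → K,
      ∑ r, c r * (t r (a, b) (y₂, y₃)) ^ 2 = (Matrix.of ![a, b, y₂, y₃]).permanent)
    [CharZero K] (w : Fin 4 → K) (hw : ∀ (a b : Fin 4 → K) (r : Fin 8), t r (a, b) (0, w) = 0) :
    w = 0 := by
  set o : Fin 4 → K := fun _ => 1 with ho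
  refine eq_zero_of_per_ones w fun y => ?_
  have h := polar c t hJ o o 0 w y 0
  rw [per_zero_row₃, zero_add, per_swap_row₂₃] at h
  rw [← h]
  rw [show ∑ r, c r * t r (o, o) (0, w) * t r (o, o) (y, 0) = 0 from
    Finset.sum_eq_zero fun r _ => by rw [hw, mul_zero, zero_mul], mul_zero]

/-! ### The family step -/

/-- **The family step.**  At a base point `u = (a, β e₂ + γ e₃)` with
`a₀ a₁ β γ (a₂ γ + a₃ β) ≠ 0`, with `k = β e₂ - γ e₃`: either `t_r(u, (k, 0)) = 0` for all `r`,
or `t_r(u, (0, k)) = 0` for all `r`.  See the module docstring for the proof. [folklore] -/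
theorem family_step [CharZero K] (c : Fin 8 → K)
    (t : Fin 8 → (((Fin 4 → K) × (Fin 4 → K)) →ₗ[K] ((Fin 4 → K) × (Fin 4 → K)) →ₗ[K] K))
    (hJ : ∀ a b y₂ y₃ : Fin 4 → K,
      ∑ r, c r * (t r (a, b) (y₂, y₃)) ^ 2 = (Matrix.of ![a, b, y₂, y₃]).permanent)
    (a : Fin 4 → K) (β γ : K) (hgood : a 0 * a 1 * β * γ * (a 2 * γ + a 3 * β) ≠ 0) :
    (∀ r, t r (a, β • Pi.single (2 : Fin 4) (1 : K) + γ • Pi.single 3 1)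
        (β • Pi.single (2 : Fin 4) (1 : K) - γ • Pi.single 3 1, 0) = 0) ∨
    (∀ r, t r (a, β • Pi.single (2 : Fin 4) (1 : K) + γ • Pi.single 3 1)
        (0, β • Pi.single (2 : Fin 4) (1 : K) - γ • Pi.single 3 1) = 0) := by
  set b : Fin 4 → K := β • Pi.single (2 : Fin 4) (1 : K) + γ • Pi.single 3 1 with hb
  set k : Fin 4 → K := β • Pi.single (2 : Fin 4) (1 : K) - γ • Pi.single 3 1 with hk
  have hc := coeff_ne_zero c t hJ
  have hgood' := hgood
  simp only [ne_eq, mul_eq_zero, not_or] at hgood'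
  obtain ⟨⟨⟨⟨ha0, ha1⟩, hβ⟩, hγ⟩, hm⟩ := hgood'
  -- `(k, 0)` is in the radical of the pairing at `u`
  have hrad : ∀ y₂' y₃' : Fin 4 → K, ∑ r, c r * t r (a, b) (k, 0) * t r (a, b) (y₂', y₃') = 0 := by
    intro y₂' y₃'
    have h := polar c t hJ a b k 0 y₂' y₃'
    rw [hb, hk, per_family_kernel, ← hb, per_zero_row₃, add_zero] at h
    exact (mul_eq_zero.1 h).resolve_left two_ne_zero
  -- hence the forms `t_r(u, ·)` have a common non-trivial zero `w`
  let Tu : ((Fin 4 → K) × (Fin 4 → K)) →ₗ[K] (Fin 8 → K) := LinearMap.pi fun r => t r (a, b)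
  have hTu : ∀ y r, Tu y r = t r (a, b) y := fun y r => rfl
  have hker : LinearMap.ker Tu ≠ ⊥ := by
    intro hbot
    have hinj : Function.Injective Tu := LinearMap.ker_eq_bot.1 hbot
    have hsurj : Function.Surjective Tu :=
      (LinearMap.injective_iff_surjective_of_finrank_eq_finrank (by
        rw [finrank_prod, finrank_fintype_fun_eq_card, finrank_fintype_fun_eq_card,
          Fintype.card_fin, Fintype.card_fin])).1 hinj
    have hk0 : Tu (k, 0) = 0 := by
      funext r
      obtain ⟨y', hy'⟩ := hsurj (Pi.single r 1)
      have h := hrad y'.1 y'.2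
      have hy'' : ∀ r', t r' (a, b) (y'.1, y'.2) = (Pi.single r (1 : K) : Fin 8 → K) r' :=
        fun r' => by rw [Prod.mk.eta, ← hTu, hy']
      simp_rw [hy'', Pi.single_apply, mul_ite, mul_one, mul_zero, Finset.sum_ite_eq',
        Finset.mem_univ, if_true] at h
      rw [hTu, Pi.zero_apply]
      exact (mul_eq_zero.1 h).resolve_left (hc r)
    have h0 : ((k, 0) : (Fin 4 → K) × (Fin 4 → K)) = 0 := hinj (by rw [hk0, map_zero])
    have : k 2 = 0 := by rw [(Prod.mk_eq_zero.1 h0).1]; rfl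
    simp [hk] at this
    exact hβ this
  obtain ⟨w, hw, hw0⟩ := Submodule.exists_mem_ne_zero_of_ne_bot hker
  have hTw : ∀ r, t r (a, b) (w.1, w.2) = 0 := fun r => by
    rw [Prod.mk.eta, ← hTu]; exact congr_fun (LinearMap.mem_ker.1 hw) r
  -- both halves of `w` are kernel vectors of the pairing, hence multiples of `k`
  have hw1 : ∀ v, (Matrix.of ![a, b, v, w.1]).permanent = 0 := by
    intro v
    have h := polar c t hJ a b w.1 w.2 0 v
    rw [per_zero_row₂, add_zero, show ∑ r, c r * t r (a, b) (w.1, w.2) * t r (a, b) (0, v) = 0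
      from Finset.sum_eq_zero fun r _ => by rw [hTw, mul_zero, zero_mul], mul_zero] at h
    rw [← per_swap_row₂₃]; exact h.symm
  have hw2 : ∀ v, (Matrix.of ![a, b, v, w.2]).permanent = 0 := by
    intro v
    have h := polar c t hJ a b w.1 w.2 v 0
    rw [per_zero_row₃, zero_add, show ∑ r, c r * t r (a, b) (w.1, w.2) * t r (a, b) (v, 0) = 0
      from Finset.sum_eq_zero fun r _ => by rw [hTw, mul_zero, zero_mul], mul_zero] at h
    exact h.symm
  have e1 := kernel_family a w.1 β γ hgood hw1
  have e2 := kernel_family a w.2 β γ hgood hw2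
  rw [← hk] at e1 e2
  set α := w.1 2 / β with hα
  set α' := w.2 2 / β with hα'
  -- differentiate `hJ` at `u` in the direction `(0, e₀)`
  have hd1 := hJ a (b + Pi.single 0 1) w.1 w.2
  have hd2 := hJ 0 (Pi.single 0 1) w.1 w.2
  have hd0 := hJ a b w.1 w.2
  have hsplit : ∀ r, t r (a, b + Pi.single 0 1) (w.1, w.2) = t r (0, Pi.single 0 1) (w.1, w.2) :=
    fun r => by
      have : ((a, b + Pi.single 0 1) : (Fin 4 → K) × (Fin 4 → K)) = (a, b) + (0, Pi.single 0 1) := by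
        ext <;> simp
      rw [this, map_add, LinearMap.add_apply, hTw r, zero_add]
  simp_rw [hsplit] at hd1
  rw [per_add_row₁] at hd1
  rw [per_zero_row₀] at hd2
  simp_rw [hTw] at hd0
  simp only [ne_eq, OfNat.ofNat_ne_zero, not_false_eq_true, zero_pow, mul_zero,
    Finset.sum_const_zero] at hd0
  have hder : (Matrix.of ![a, Pi.single 0 1, w.1, w.2]).permanent = 0 := by
    linear_combination hd2 - hd1 + hd0
  rw [e1, e2, per_smul_row₂, per_smul_row₃, hk, per_family_deriv] at hder
  have hαα : α * α' = 0 := by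
    have : α * α' * (-(2 * a 1 * β * γ)) = 0 := by linear_combination hder
    refine (mul_eq_zero.1 this).resolve_right ?_
    exact neg_ne_zero.2 (mul_ne_zero (mul_ne_zero (mul_ne_zero two_ne_zero ha1) hβ) hγ)
  rcases mul_eq_zero.1 hαα with h0 | h0
  · -- `w.1 = 0`, so `w = (0, α' k)` with `α' ≠ 0`
    right
    have hw1z : w.1 = 0 := by rw [e1, h0, zero_smul]
    have hα'0 : α' ≠ 0 := by
      intro h'
      apply hw0
      exact Prod.ext hw1z (by rw [e2, h', zero_smul]; rfl)
    intro r
    have h := hTw r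
    rw [hw1z, e2, show ((0 : Fin 4 → K), α' • k) = α' • ((0 : Fin 4 → K), k) by simp, map_smul,
      smul_eq_mul] at h
    exact (mul_eq_zero.1 h).resolve_left hα'0
  · left
    have hw2z : w.2 = 0 := by rw [e2, h0, zero_smul]
    have hα0 : α ≠ 0 := by
      intro h'
      apply hw0
      exact Prod.ext (by rw [e1, h', zero_smul]; rfl) hw2z
    intro r
    have h := hTw r
    rw [hw2z, e1, show ((α • k, (0 : Fin 4 → K)) : (Fin 4 → K) × (Fin 4 → K)) =
      α • (k, (0 : Fin 4 → K)) by simp, map_smul, smul_eq_mul] at h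
    exact (mul_eq_zero.1 h).resolve_left hα0


/-! ### From the family step to identities on the whole family (polynomiality along lines) -/

/-- **The family alternative holds uniformly.**  For a joint `8`-square family: either
`t_r((a, b), (b₂ e₂ - b₃ e₃, 0)) = 0` for ALL `a`, all `b ∈ span(e₂, e₃)` and all `r`, or
`t_r((a, b), (0, b₂ e₂ - b₃ e₃)) = 0` for all of them (the family step on the dense set
`a₀ a₁ b₂ b₃ (a₂ b₃ + a₃ b₂) ≠ 0`, then polynomiality along lines). [folklore] -/
theorem family₂₃ [CharZero K] (c : Fin 8 → K)
    (t : Fin 8 → (((Fin 4 → K) × (Fin 4 → K)) →ₗ[K] ((Fin 4 → K) × (Fin 4 → K)) →ₗ[K] K))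
    (hJ : ∀ a b y₂ y₃ : Fin 4 → K,
      ∑ r, c r * (t r (a, b) (y₂, y₃)) ^ 2 = (Matrix.of ![a, b, y₂, y₃]).permanent) :
    (∀ (a b : Fin 4 → K), b 0 = 0 → b 1 = 0 → ∀ r,
        t r (a, b) (b 2 • Pi.single (2 : Fin 4) (1 : K) - b 3 • Pi.single 3 1, 0) = 0) ∨
    (∀ (a b : Fin 4 → K), b 0 = 0 → b 1 = 0 → ∀ r,
        t r (a, b) (0, b 2 • Pi.single (2 : Fin 4) (1 : K) - b 3 • Pi.single 3 1) = 0) := by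
  -- linear parametrisation of the family by `P = (Fin 4 → K) × (K × K)`
  let L : (K × K) →ₗ[K] (Fin 4 → K) :=
    (LinearMap.fst K K K).smulRight (Pi.single 2 1) + (LinearMap.snd K K K).smulRight (Pi.single 3 1)
  let L' : (K × K) →ₗ[K] (Fin 4 → K) :=
    (LinearMap.fst K K K).smulRight (Pi.single 2 1) - (LinearMap.snd K K K).smulRight (Pi.single 3 1)
  let φ : ((Fin 4 → K) × (K × K)) →ₗ[K] ((Fin 4 → K) × (Fin 4 → K)) :=
    (LinearMap.fst K (Fin 4 → K) (K × K)).prod (L ∘ₗ LinearMap.snd K (Fin 4 → K) (K × K))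
  let ψ₂ : ((Fin 4 → K) × (K × K)) →ₗ[K] ((Fin 4 → K) × (Fin 4 → K)) :=
    LinearMap.inl K (Fin 4 → K) (Fin 4 → K) ∘ₗ L' ∘ₗ LinearMap.snd K (Fin 4 → K) (K × K)
  let ψ₃ : ((Fin 4 → K) × (K × K)) →ₗ[K] ((Fin 4 → K) × (Fin 4 → K)) :=
    LinearMap.inr K (Fin 4 → K) (Fin 4 → K) ∘ₗ L' ∘ₗ LinearMap.snd K (Fin 4 → K) (K × K)
  have hφ : ∀ z, φ z = (z.1, z.2.1 • Pi.single (2 : Fin 4) (1 : K) + z.2.2 • Pi.single 3 1) :=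
    fun z => rfl
  have hψ₂ : ∀ z, ψ₂ z = (z.2.1 • Pi.single (2 : Fin 4) (1 : K) - z.2.2 • Pi.single 3 1, 0) :=
    fun z => rfl
  have hψ₃ : ∀ z, ψ₃ z = (0, z.2.1 • Pi.single (2 : Fin 4) (1 : K) - z.2.2 • Pi.single 3 1) :=
    fun z => rfl
  let f : Fin 8 → ((Fin 4 → K) × (K × K)) → K := fun r z => t r (φ z) (ψ₂ z)
  let g : Fin 8 → ((Fin 4 → K) × (K × K)) → K := fun r z => t r (φ z) (ψ₃ z)
  let h : ((Fin 4 → K) × (K × K)) → K := fun z =>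
    z.1 0 * z.1 1 * z.2.1 * z.2.2 * (z.1 2 * z.2.2 + z.1 3 * z.2.1)
  have key : ∀ r r', (∀ z, f r z = 0) ∨ (∀ z, g r' z = 0) := by
    intro r r'
    have H := forall_eq_zero_or_of_mul₃ (⊤ : Submodule K ((Fin 4 → K) × (K × K)))
      (f := f r) (g := g r') (h := h)
      (linePoly_bilin (t r) φ ψ₂) (linePoly_bilin (t r') φ ψ₃) linePoly_good (by
        intro z _
        by_cases hz : h z = 0
        · rw [hz, mul_zero]
        · rcases family_step c t hJ z.1 z.2.1 z.2.2 hz with H | H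
          · rw [show f r z = 0 from H r, zero_mul, zero_mul]
          · rw [show g r' z = 0 from H r', mul_zero, zero_mul])
    rcases H with H | H | H
    · exact Or.inl fun z => H z Submodule.mem_top
    · exact Or.inr fun z => H z Submodule.mem_top
    · exfalso
      have := H ((fun _ => (1 : K)), ((1 : K), (1 : K))) Submodule.mem_top
      norm_num [h] at this
  by_cases hB : ∀ r' z, g r' z = 0
  · right
    intro a b hb0 hb1 r
    have := hB r (a, (b 2, b 3))
    simp only [g, hφ, hψ₃] at this
    rwa [← eq_single_add_single b hb0 hb1] at this
  · push Not at hB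
    obtain ⟨r', z', hz'⟩ := hB
    left
    intro a b hb0 hb1 r
    rcases key r r' with H | H
    · have := H (a, (b 2, b 3))
      simp only [f, hφ, hψ₂] at this
      rwa [← eq_single_add_single b hb0 hb1] at this
    · exact absurd (H z') hz'

end Summit.ValiantsHypothesis.ValiantsHypothesis.Theorems.SymPencilPerFourInnerRankFamily

end
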